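import Mathlib.Probability.Distributions.Gaussian.IsGaussianProcess.Basic
import Mathlib.Analysis.Calculus.ContDiff.Defs
import Mathlib.MeasureTheory.Integral.Bochner.Basic
import Mathlib.Analysis.SpecialFunctions.Log.Basic
import Literature.Probability.RandomPlanarGeometry.ConformalMap
import Mathlib.Analysis.Distribution.TestFunction
import HarnessLib

/-!
# The Dirichlet (zero-boundary) Gaussian free field on a simply connected planar domain

Topic `Literature/Probability/RandomPlanarGeometry` (definition item `defn-DirichletGFFandIGCoupling`,
part (a): `DirichletGFF`; for routes `CriticalPhenomena/CardyWindingIG` (WindingFieldGFF,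
IGCouplingRigidity) and `SAWImaginaryGeometry`).

Miller–Sheffield, *Imaginary geometry I*, Probab. Theory Relat. Fields 164 (2016) = arXiv:1201.1496,
§3.1 ("The zero-boundary GFF `h` on `D` … is the Gaussian process with covariance
`Cov(h(f), h(g)) = ∬ f(x) G(x,y) g(y) dx dy`, `G` the Green's function of `Δ` on `D` with Dirichlet
boundary conditions", normalised so that `G(x,y) ∼ −log|x−y|` on the diagonal); Sheffield,
*Gaussian free fields for mathematicians*, PTRF 139 (2007), §2; Werner–Powell, *Lecture notes on the
Gaussian free field* (2021), §1.2–1.5.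

## Rendering

A random distribution is modelled by its evaluations on test functions: the state space is
`GFFTestFunction U → ℝ` (all functionals on `C_c^∞(U; ℝ)`, product = cylinder σ-algebra), the field is
the coordinate process `f ↦ (ω ↦ ω f)`, and a law of the GFF is a probability measure `P` on it
under which this process is centred Gaussian (Mathlib's `ProbabilityTheory.IsGaussianProcess`: every
finite-dimensional marginal is Gaussian) with the Green covariance. Linearity `ω(f+g) = ω f + ω g`
then holds `P`-a.s. for each pair (the difference is a centred Gaussian of variance `0`), which is all
"random distribution" means at the level of finite-dimensional marginals (DKLM arXiv:2603.06268
Def. 2.6–2.7: convergence of `k`-point functions / of finite-dimensional marginals are statements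
about exactly these objects; the negative-Sobolev-space version is a statement about a modification
and is not fixed here).

The Dirichlet Green function of a simply connected `U ⊊ ℂ` is transported from the upper half-plane:
`G_U(x,y) = G_ℍ(ψ⁻¹x, ψ⁻¹y)`, `G_ℍ(z,w) = log|z − w̄| − log|z − w|` (`= −log|z−w| + O(1)` near the
diagonal, `> 0`, zero boundary values), for a conformal equivalence `ψ : ℍ ≃ U` (the tree's
`ConformalEquiv upperHalfPlaneSet U`); the result does not depend on `ψ` (Möbius invariance of
`G_ℍ`), so the definition quantifies `ψ` existentially — which also builds in that `U` is a proper
simply connected domain (Riemann mapping theorem, `exists_conformalEquiv_upperHalfPlaneSet`).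

* `GFFTestFunction U` — Mathlib's bundled `TestFunction ⟨interior U, _⟩ ℝ ⊤` (`𝓓(interior U, ℝ)`),
  an `abbrev` (no new test-function type).
* `upperHalfPlaneGreen`, `ConformalEquiv.dirichletGreen ψ`, `greenPairing G f g = ∬ f G g`.
* `IsDirichletGFF U P` — the definition.
* API: `upperHalfPlaneGreen_comm`, `dirichletGreen_comm`, `IsDirichletGFF.isProbabilityMeasure`,
  `IsDirichletGFF.integral_eval`, `IsDirichletGFF.covariance`.

Deliberately NOT here (part (b) of the definition item and beyond): the imaginary-geometry coupling
axioms `IsImaginaryGeometryCoupling κ′ D μ` (they need a consistent choice of the branch of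
`arg f′` along the exploration — see the work-item note), free/mixed boundary conditions, the GFF
as a random element of `H^{−ε}`, Markov property and conformal invariance as theorems.
-/

noncomputable section

open MeasureTheory ProbabilityTheory
open scoped ContDiff

namespace Literature.Probability.RandomPlanarGeometry

/-- The index set of the GFF on `U` as a random distribution: Mathlib's bundled **test functions**
`𝓓(interior U, ℝ) = TestFunction ⟨interior U, _⟩ ℝ ⊤` — smooth real functions on `ℂ = ℝ²` with
compact support inside the open set `interior U` (`= U` for the open sets that carry a GFF; the
`interior` lets `U : Set ℂ` be any set, matching the `Set ℂ`-valued domains of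
`RandomPlanarGeometry`). An `abbrev`, so all of Mathlib's `TestFunction` API applies. [cite: Sheffield2007, §2.1] -/
abbrev GFFTestFunction (U : Set ℂ) : Type :=
  _root_.TestFunction (⟨interior U, isOpen_interior⟩ : TopologicalSpace.Opens ℂ) ℝ ⊤

/-- **Green function of the upper half-plane** with Dirichlet boundary conditions, in the
normalisation `G(z,w) = −log|z − w| + O(1)`: `G_ℍ(z,w) = log|z − w̄| − log|z − w|`. (On the
diagonal Lean's `Real.log 0 = 0` gives the junk value `log(2 Im z)`; the diagonal is Lebesgue-null
and never used pointwise.) [cite: MillerSheffield2016, §3.1 (Green's function normalisation)] -/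
def upperHalfPlaneGreen (z w : ℂ) : ℝ :=
  Real.log ‖z - (starRingEnd ℂ) w‖ - Real.log ‖z - w‖

/-- `G_ℍ` is symmetric. [folklore] -/
theorem upperHalfPlaneGreen_comm (z w : ℂ) : upperHalfPlaneGreen z w = upperHalfPlaneGreen w z := by
  unfold upperHalfPlaneGreen
  have h1 : ‖z - (starRingEnd ℂ) w‖ = ‖w - (starRingEnd ℂ) z‖ := by
    rw [← Complex.norm_conj (z - (starRingEnd ℂ) w)]
    simp only [map_sub, Complex.conj_conj]
    rw [← norm_neg]
    congr 1
    ring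
  rw [h1, norm_sub_rev z w]

/-- **Dirichlet Green function of `U` transported by a conformal equivalence `ψ : ℍ ≃ U`**:
`G_U(x,y) = G_ℍ(ψ⁻¹ x, ψ⁻¹ y)` (conformal invariance of the Green function; independent of the choice
of `ψ`). Junk outside `U × U`. [cite: MillerSheffield2016, §3.1] -/
def ConformalEquiv.dirichletGreen {U : Set ℂ} (ψ : ConformalEquiv UpperHalfPlane.upperHalfPlaneSet U)
    (x y : ℂ) : ℝ :=
  upperHalfPlaneGreen (ψ.toPartialEquiv.symm x) (ψ.toPartialEquiv.symm y)

/-- `G_U` is symmetric. [folklore] -/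
theorem ConformalEquiv.dirichletGreen_comm {U : Set ℂ}
    (ψ : ConformalEquiv UpperHalfPlane.upperHalfPlaneSet U) (x y : ℂ) :
    ψ.dirichletGreen x y = ψ.dirichletGreen y x :=
  upperHalfPlaneGreen_comm _ _

/-- The **Green pairing** `∬ f(x) G(x,y) g(y) dx dy` (Lebesgue measure on `ℂ = ℝ²`), the covariance
of the GFF tested against `f` and `g`. A Bochner double integral: for genuine `f, g ∈ C_c^∞(U)` and
`G = G_U` the integrand is integrable (logarithmic singularity on the diagonal, `G_U` continuous off
it on `U × U`, `f`, `g` vanish where `ψ⁻¹` is junk), so no junk value intervenes in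
`IsDirichletGFF`. [cite: MillerSheffield2016, §3.1] -/
def greenPairing (G : ℂ → ℂ → ℝ) (f g : ℂ → ℝ) : ℝ :=
  ∫ x, ∫ y, f x * G x y * g y

/-- **The Dirichlet Gaussian free field on `U`** (zero boundary conditions), as the law `P` of a
random distribution tested on `C_c^∞(U)`: `P` is a probability measure on `GFFTestFunction U → ℝ` under
which the coordinate process `f ↦ (ω ↦ ω f)` is a centred Gaussian process whose covariance is the
Green pairing `E[h(f) h(g)] = ∬ f G_U g` for the Dirichlet Green function of `U` (transported from
`ℍ` by some — equivalently any — conformal equivalence `ψ : ℍ ≃ U`; in particular `U` is a proper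
simply connected domain). (Miller–Sheffield IG I §3.1; Sheffield 2007 §2.) [cite: MillerSheffield2016, §3.1 (the GFF as a Gaussian process indexed by test functions)]
[cite: Sheffield2007, §2] -/
def IsDirichletGFF (U : Set ℂ) (P : Measure (GFFTestFunction U → ℝ)) : Prop :=
  IsProbabilityMeasure P ∧
  IsGaussianProcess (fun (f : GFFTestFunction U) (h : GFFTestFunction U → ℝ) => h f) P ∧
  (∀ f : GFFTestFunction U, ∫ h, h f ∂P = 0) ∧
  ∃ ψ : ConformalEquiv UpperHalfPlane.upperHalfPlaneSet U,
    ∀ f g : GFFTestFunction U, ∫ h, h f * h g ∂P = greenPairing ψ.dirichletGreen f g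

namespace IsDirichletGFF

variable {U : Set ℂ} {P : Measure (GFFTestFunction U → ℝ)}

/-- The law of a GFF is a probability measure. [folklore] -/
theorem isProbabilityMeasure (hP : IsDirichletGFF U P) : IsProbabilityMeasure P := hP.1

/-- The GFF is a Gaussian process indexed by test functions. [cite: Sheffield2007, §2] -/
theorem isGaussianProcess (hP : IsDirichletGFF U P) :
    IsGaussianProcess (fun (f : GFFTestFunction U) (h : GFFTestFunction U → ℝ) => h f) P := hP.2.1

/-- The GFF is centred. [cite: Sheffield2007, §2] -/
theorem integral_eval (hP : IsDirichletGFF U P) (f : GFFTestFunction U) : ∫ h, h f ∂P = 0 := hP.2.2.1 f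

/-- The covariance of the GFF is the Green pairing for some uniformising map. [cite: MillerSheffield2016, §3.1] -/
theorem covariance (hP : IsDirichletGFF U P) :
    ∃ ψ : ConformalEquiv UpperHalfPlane.upperHalfPlaneSet U,
      ∀ f g : GFFTestFunction U, ∫ h, h f * h g ∂P = greenPairing ψ.dirichletGreen f g := hP.2.2.2

end IsDirichletGFF

end Literature.Probability.RandomPlanarGeometry
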